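import Summits.QuantumFields.BalabanUV.T4Continuum.Support.NE3CovariantLineSumsError
import Summits.QuantumFields.BalabanUV.T4Continuum.Support.NE3BlockPoincareCore
import HarnessLib

/-!
# T⁴ programme, node NE3, row E-MLw-(w4)-P · C1 (file 4) — THE ℓ²(TORUS) CURRENCY OF THE ONE-LEVEL PIECES:
# `Σ_y Σ_κ ‖Qstr L W Y (y,κ)‖² ≤ (L²∕L^d)·Σ_x Σ_κ ‖Y x κ‖²` (EXACT WEIGHT, the `M^{2−d}` scaling of the straight average) and
# `Σ_y Σ_κ ‖Dstr L W Y (y,κ)‖² ≤ (16(d+1)(d+4)L²a)²·C2sq(d,L)·Σ_x Σ_κ ‖Y x κ‖²`, plus the Minkowski inequality for the torus ℓ² functional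

NE3 formalisation swarm `b2b-balaban-t4-ne3-formalise-*`, LEAF PROVER 04 (gen 4), row **C1** (owner cuts D-ne3p1-g21-1 §4 ∕ D-ne3p1-g21-2 §2),
file 4 after `NE3CovariantLineSums` ∕ `…Tower` ∕ `…Error` (sup currency).  WHY THIS CURRENCY: the assembly of (P_W) on the frame-free slice
T_♮(W) (D-ne3p1-g21-2 (V6)) feeds `S_W = E` into this unit's torus-summed core `NE3BlockPoincareLocal.sum_norm_sq_le_stable`, whose S-term is
`4·(M^d∕M²)·Σ_z Σ_κ ‖S(z,κ)‖²` — an ℓ²(coarse torus) quantity; absorbing it needs `Σ_z‖E‖² ≤ ε²·(M²∕M^d)·Σ_x‖Y‖²` with ε k-free, i.e. ℓ² → ℓ²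
bounds whose main-term weight is EXACTLY `L²∕L^d` per level (so that k levels give `M²∕M^d`).  The sup currency of file 3 cannot serve this.

CONTENT (all [folklore]; 0 sorry; DATA defs `l2sq` (the torus ℓ² functional) and `C2sq` (explicit constant) → async audit):
§1 `l2sq F f := Σ_{z∈F} Σ_κ ‖f z κ‖²`; `sqrt_l2sq_add_le` — MINKOWSKI `√l2sq(f+g) ≤ √l2sq f + √l2sq g` (Cauchy–Schwarz `Finset.sum_mul_sq_le_sq_mul_sq` by hand);
§2 **`l2sq_Qstr_le`** — for unitary small-field `W` and `(L·N′)`-periodic `Y`: `l2sq (periodBox N′) (Qstr L W Y) ≤ (L²∕L^d)·l2sq (periodBox (L·N′)) Y`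
   (`‖Qstr‖ ≤ segL1` (file 1), Cauchy–Schwarz on the `L^d·L` terms of the block-line sum, the exact tiling `sum_univ_boxVec` ∕ `sum_blocks_torus_shift`);
§3 **`l2sq_Dstr_le`** — `l2sq (periodBox N′) (Dstr L W Y) ≤ (16(d+1)(d+4)L²a)²·C2sq d L·l2sq (periodBox (L·N′)) Y`, `C2sq d L = d²·Csup²·(2·nbRad+1)^{2d}`
   (`‖Dstr‖ ≤ w·locL1` (file 1), `locL1 ≤ Csup·dirL1(box nbRad)` by `AveragingDeficitPlaqLin.lnorm_le_region`, Cauchy–Schwarz on the box, and the torus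
   box multiplicity `AveragingDeficitPeriodicCounting.sum_periodBox_box_le`).  The constant is crude (box counting, not word counting) but k-, N-, M-FREE;
   the k-level ℓ² recursion (file 3's induction with `L ↦ √(L²∕L^d)` and Minkowski in place of the triangle inequality) is file 5 (this lineage).

HONEST: covariant kinematics on OUR frame; nothing about minimisers, (P_W), (ML_w), T-E_w or NE3 is asserted; NE3 NOT proved; spine 0∕9; finite T⁴ rung
(B)+1 — NOT infinite volume, NOT mass gap, NOT BetaPertH, NOT Clay.  PLACEMENT: `Summits/QuantumFields/BalabanUV/`.
-/

set_option autoImplicit false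

open scoped BigOperators Matrix.Norms.L2Operator
open Finset

namespace Summit.QuantumFields.BalabanUV.T4Continuum.NE3CovariantLineSumsL2

open Literature.MathematicalPhysics.QuantumFieldTheory.Balaban1983to89
open B7Prop1Explicit B7Prop2Explicit
open T4AveragingDeficitWall (IsUnitaryCfg IsSkewDir SmallField Ad dirL1 box)
open T4AveragingDeficitWallBoundary (periodBox card_periodBox sum_periodBox_shift)
open AveragingDeficitPeriodicCounting (IsPeriodicDir sum_periodBox_box_le)
open AveragingDeficitCounting (card_box_eq)
open AveragingDeficitTransport (lnorm)
open AveragingDeficitPlaqLin (lnorm_le_region dirL1_eq_sum_prod)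
open AveragingDeficitSideDeriv (loopWord)
open BlockAverageDbarLinBound (segMain loopL1 treeL1' segL1)
open BlockAverageDbarLinNorms (lnorm_seg_eq_sum l1_natCast_smul_e)
open BlockAverageVaryHolo (nbRad length_loopWord_le)
open NE3BlockLineAverage (sum_univ_boxVec)
open NE3BlockPoincareCore (sum_blocks_torus_shift sum_rotate3)
open NE3CovariantLineSums (Qstr locL1 wBall_le norm_Qbar_sub_Qstr_le norm_Qstr_le)
open NE3CovariantLineSumsTower (Dstr)
open NE3CovariantLineSumsError (Csup Csup_nonneg)

noncomputable section

variable {d : ℕ} {n : Type*} [Fintype n] [DecidableEq n]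

/-! ## §1 The torus ℓ² functional and Minkowski -/

/-- THE TORUS ℓ² FUNCTIONAL of a direction over a window: `l2sq F f = Σ_{z∈F} Σ_κ ‖f z κ‖²`. [folklore] -/
def l2sq (F : Finset (Site d)) (f : Site d → Fin d → Matrix n n ℂ) : ℝ := ∑ z ∈ F, ∑ κ : Fin d, ‖f z κ‖ ^ 2

/-- `0 ≤ l2sq`. [folklore] -/
theorem l2sq_nonneg (F : Finset (Site d)) (f : Site d → Fin d → Matrix n n ℂ) : 0 ≤ l2sq F f := by
  unfold l2sq; positivity

/-- `l2sq` as a single sum over `F ×ˢ univ`. [folklore] -/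
theorem l2sq_eq_sum_product (F : Finset (Site d)) (f : Site d → Fin d → Matrix n n ℂ) :
    l2sq F f = ∑ p ∈ F ×ˢ (Finset.univ : Finset (Fin d)), ‖f p.1 p.2‖ ^ 2 := by
  unfold l2sq; rw [Finset.sum_product]

/-- **MINKOWSKI** for the torus ℓ² functional: `√l2sq F (f + g) ≤ √l2sq F f + √l2sq F g`. [folklore] -/
theorem sqrt_l2sq_add_le (F : Finset (Site d)) (f g : Site d → Fin d → Matrix n n ℂ) :
    Real.sqrt (l2sq F (fun z κ => f z κ + g z κ)) ≤ Real.sqrt (l2sq F f) + Real.sqrt (l2sq F g) := by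
  set P := F ×ˢ (Finset.univ : Finset (Fin d)) with hP
  set A : ℝ := l2sq F f with hA
  set B : ℝ := l2sq F g with hB
  have hA0 : 0 ≤ A := l2sq_nonneg F f
  have hB0 : 0 ≤ B := l2sq_nonneg F g
  -- Cauchy–Schwarz for the cross term
  have hcs : ∑ p ∈ P, ‖f p.1 p.2‖ * ‖g p.1 p.2‖ ≤ Real.sqrt A * Real.sqrt B := by
    have h := Finset.sum_mul_sq_le_sq_mul_sq P (fun p => ‖f p.1 p.2‖) (fun p => ‖g p.1 p.2‖)
    have hA' : ∑ p ∈ P, ‖f p.1 p.2‖ ^ 2 = A := by rw [hA, l2sq_eq_sum_product]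
    have hB' : ∑ p ∈ P, ‖g p.1 p.2‖ ^ 2 = B := by rw [hB, l2sq_eq_sum_product]
    rw [hA', hB'] at h
    have hS0 : 0 ≤ ∑ p ∈ P, ‖f p.1 p.2‖ * ‖g p.1 p.2‖ := Finset.sum_nonneg fun _ _ => by positivity
    rw [← Real.sqrt_mul hA0, Real.le_sqrt hS0 (mul_nonneg hA0 hB0)]
    exact h
  have hsum : l2sq F (fun z κ => f z κ + g z κ) ≤ (Real.sqrt A + Real.sqrt B) ^ 2 := by
    rw [l2sq_eq_sum_product]
    calc ∑ p ∈ P, ‖f p.1 p.2 + g p.1 p.2‖ ^ 2 ≤ ∑ p ∈ P, (‖f p.1 p.2‖ + ‖g p.1 p.2‖) ^ 2 :=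
          Finset.sum_le_sum fun p _ => pow_le_pow_left₀ (norm_nonneg _) (norm_add_le _ _) 2
      _ = ∑ p ∈ P, ‖f p.1 p.2‖ ^ 2 + ∑ p ∈ P, ‖g p.1 p.2‖ ^ 2 + 2 * ∑ p ∈ P, ‖f p.1 p.2‖ * ‖g p.1 p.2‖ := by
          rw [← Finset.sum_add_distrib, Finset.mul_sum, ← Finset.sum_add_distrib]
          exact Finset.sum_congr rfl fun p _ => by ring
      _ = A + B + 2 * ∑ p ∈ P, ‖f p.1 p.2‖ * ‖g p.1 p.2‖ := by rw [← l2sq_eq_sum_product, ← l2sq_eq_sum_product]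
      _ ≤ A + B + 2 * (Real.sqrt A * Real.sqrt B) := by linarith [hcs]
      _ = (Real.sqrt A + Real.sqrt B) ^ 2 := by
          rw [add_sq, Real.sq_sqrt hA0, Real.sq_sqrt hB0]; ring
  have hR0 : 0 ≤ Real.sqrt A + Real.sqrt B := add_nonneg (Real.sqrt_nonneg _) (Real.sqrt_nonneg _)
  rw [← Real.sqrt_sq hR0]
  exact Real.sqrt_le_sqrt hsum

/-! ## §2 The straight average contracts the torus ℓ² functional with the exact weight `L²∕L^d` -/

omit [Fintype n] [DecidableEq n] in
/-- The straight tiling with `L` longitudinal shifts: `Σ_y Σ_{v∈B_L} Σ_{i<L} g(L•y + v + i•e_κ) = L·Σ_x g x` for `(L·N′)`-periodic `g`. [folklore] -/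
theorem sum_tile_shift {L N' : ℕ} (hL : 1 ≤ L) (hN' : 1 ≤ N') (g : Site d → ℝ)
    (hg : ∀ (x : Site d) (τ : Fin d), g (x + ((L * N' : ℕ) : ℤ) • e τ) = g x) (κ : Fin d) :
    ∑ y ∈ periodBox (d := d) N', ∑ v ∈ periodBox (d := d) L, ∑ i ∈ range L, g ((L : ℤ) • y + v + (i : ℤ) • e κ)
      = L * ∑ x ∈ periodBox (d := d) (L * N'), g x := by
  rw [sum_rotate3]
  calc ∑ i ∈ range L, ∑ y ∈ periodBox (d := d) N', ∑ v ∈ periodBox (d := d) L, g ((L : ℤ) • y + v + (i : ℤ) • e κ)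
      = ∑ _i ∈ range L, ∑ x ∈ periodBox (d := d) (L * N'), g x :=
        Finset.sum_congr rfl fun i _ => sum_blocks_torus_shift (g := g) hL hN' hg ((i : ℤ) • e κ)
    _ = L * ∑ x ∈ periodBox (d := d) (L * N'), g x := by rw [Finset.sum_const, card_range, nsmul_eq_mul]

/-- **THE STRAIGHT COVARIANT AVERAGE IN ℓ²(TORUS), EXACT WEIGHT**: for unitary small-field `W` (`512(d+1)(d+4)L²a ≤ 1`, `SmallField W a`) and an
`(L·N′)`-periodic `Y`, `l2sq (periodBox N′) (Qstr L W Y) ≤ (L²∕L^d)·l2sq (periodBox (L·N′)) Y`. [folklore] -/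
theorem l2sq_Qstr_le [Nonempty n] {L : ℕ} (hL : 1 ≤ L) {N' : ℕ} (hN' : 1 ≤ N') {W : Site d → Fin d → (Matrix n n ℂ)ˣ}
    (hWu : IsUnitaryCfg W) {a : ℝ} (ha : 0 ≤ a) (hsmall : 512 * (d + 1) * (d + 4) * (L : ℝ) ^ 2 * a ≤ 1) (hWa : SmallField W a)
    {Y : Site d → Fin d → Matrix n n ℂ} (hY : IsPeriodicDir Y ((L * N' : ℕ) : ℤ)) :
    l2sq (periodBox (d := d) N') (Qstr L W Y) ≤ (L : ℝ) ^ 2 / (L : ℝ) ^ d * l2sq (periodBox (d := d) (L * N')) Y := by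
  have hL0 : (0 : ℝ) < L := by exact_mod_cast (by omega : 0 < L)
  have hLd : (0 : ℝ) < (L : ℝ) ^ d := by positivity
  -- pointwise: `‖Qstr‖² ≤ L^{1-d}·Σ_r Σ_i ‖Y‖²`
  have hpt : ∀ (y : Site d) (κ : Fin d), ‖Qstr L W Y y κ‖ ^ 2
      ≤ (L : ℝ) / (L : ℝ) ^ d * ∑ v ∈ periodBox (d := d) L, ∑ i ∈ range L, ‖Y ((L : ℤ) • y + v + (i : ℤ) • e κ) κ‖ ^ 2 := by
    intro y κ
    have h1 := norm_Qstr_le hL hWu ha hsmall hWa Y y κ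
    have hseg : segL1 L Y ((L : ℤ) • y) κ
        = ((L : ℝ) ^ d)⁻¹ * ∑ v ∈ periodBox (d := d) L, ∑ i ∈ range L, ‖Y ((L : ℤ) • y + v + (i : ℤ) • e κ) κ‖ := by
      unfold segL1
      rw [← Finset.mul_sum, ← sum_univ_boxVec L (fun v => ∑ i ∈ range L, ‖Y ((L : ℤ) • y + v + (i : ℤ) • e κ) κ‖)]
      refine congrArg _ (Finset.sum_congr rfl fun r _ => ?_)
      rw [lnorm_seg_eq_sum]
    -- Cauchy–Schwarz over the `L^d·L` terms
    set T : Finset (Site d × ℕ) := periodBox (d := d) L ×ˢ range L with hT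
    have hcardT : (T.card : ℝ) = (L : ℝ) ^ d * L := by
      rw [hT, Finset.card_product, card_periodBox, card_range]; push_cast; ring
    have hdouble : ∑ v ∈ periodBox (d := d) L, ∑ i ∈ range L, ‖Y ((L : ℤ) • y + v + (i : ℤ) • e κ) κ‖
        = ∑ p ∈ T, ‖Y ((L : ℤ) • y + p.1 + (p.2 : ℤ) • e κ) κ‖ := by rw [hT, Finset.sum_product]
    have hdouble2 : ∑ v ∈ periodBox (d := d) L, ∑ i ∈ range L, ‖Y ((L : ℤ) • y + v + (i : ℤ) • e κ) κ‖ ^ 2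
        = ∑ p ∈ T, ‖Y ((L : ℤ) • y + p.1 + (p.2 : ℤ) • e κ) κ‖ ^ 2 := by rw [hT, Finset.sum_product]
    have hcs : (∑ p ∈ T, ‖Y ((L : ℤ) • y + p.1 + (p.2 : ℤ) • e κ) κ‖) ^ 2
        ≤ (T.card : ℝ) * ∑ p ∈ T, ‖Y ((L : ℤ) • y + p.1 + (p.2 : ℤ) • e κ) κ‖ ^ 2 := by
      exact_mod_cast sq_sum_le_card_mul_sum_sq (s := T) (f := fun p => ‖Y ((L : ℤ) • y + p.1 + (p.2 : ℤ) • e κ) κ‖)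
    rw [← hdouble, ← hdouble2, hcardT] at hcs
    have h0 : 0 ≤ ‖Qstr L W Y y κ‖ := norm_nonneg _
    calc ‖Qstr L W Y y κ‖ ^ 2 ≤ (segL1 L Y ((L : ℤ) • y) κ) ^ 2 := pow_le_pow_left₀ h0 h1 2
      _ = (((L : ℝ) ^ d)⁻¹) ^ 2 * (∑ v ∈ periodBox (d := d) L, ∑ i ∈ range L, ‖Y ((L : ℤ) • y + v + (i : ℤ) • e κ) κ‖) ^ 2 := by
          rw [hseg, mul_pow]
      _ ≤ (((L : ℝ) ^ d)⁻¹) ^ 2 * ((L : ℝ) ^ d * L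
            * ∑ v ∈ periodBox (d := d) L, ∑ i ∈ range L, ‖Y ((L : ℤ) • y + v + (i : ℤ) • e κ) κ‖ ^ 2) :=
          mul_le_mul_of_nonneg_left hcs (by positivity)
      _ = (L : ℝ) / (L : ℝ) ^ d * ∑ v ∈ periodBox (d := d) L, ∑ i ∈ range L, ‖Y ((L : ℤ) • y + v + (i : ℤ) • e κ) κ‖ ^ 2 := by
          field_simp
  -- sum over the coarse torus: the exact tiling, `L` shifts
  have htile : ∀ (κ : Fin d), ∑ y ∈ periodBox (d := d) N', ∑ v ∈ periodBox (d := d) L, ∑ i ∈ range L,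
      ‖Y ((L : ℤ) • y + v + (i : ℤ) • e κ) κ‖ ^ 2 = L * ∑ x ∈ periodBox (d := d) (L * N'), ‖Y x κ‖ ^ 2 := by
    intro κ
    have hper : ∀ (x : Site d) (τ : Fin d), (fun x => ‖Y x κ‖ ^ 2) (x + ((L * N' : ℕ) : ℤ) • e τ) = (fun x => ‖Y x κ‖ ^ 2) x := by
      intro x τ; simp only; rw [hY x τ κ]
    exact sum_tile_shift hL hN' (fun x => ‖Y x κ‖ ^ 2) hper κ
  unfold l2sq
  set c : ℝ := (L : ℝ) / (L : ℝ) ^ d with hc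
  set inner : Site d → Fin d → ℝ := fun y κ =>
    ∑ v ∈ periodBox (d := d) L, ∑ i ∈ range L, ‖Y ((L : ℤ) • y + v + (i : ℤ) • e κ) κ‖ ^ 2 with hinner
  have step1 : ∑ y ∈ periodBox (d := d) N', ∑ κ : Fin d, ‖Qstr L W Y y κ‖ ^ 2
      ≤ ∑ y ∈ periodBox (d := d) N', ∑ κ : Fin d, c * inner y κ :=
    Finset.sum_le_sum fun y _ => Finset.sum_le_sum fun κ _ => hpt y κ
  have step2 : ∑ y ∈ periodBox (d := d) N', ∑ κ : Fin d, c * inner y κ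
      = c * (L * ∑ x ∈ periodBox (d := d) (L * N'), ∑ κ : Fin d, ‖Y x κ‖ ^ 2) := by
    rw [Finset.sum_comm]
    simp only [← Finset.mul_sum]
    congr 1
    calc ∑ κ : Fin d, ∑ y ∈ periodBox (d := d) N', inner y κ
        = ∑ κ : Fin d, ((L : ℝ) * ∑ x ∈ periodBox (d := d) (L * N'), ‖Y x κ‖ ^ 2) :=
          Finset.sum_congr rfl fun κ _ => by rw [hinner]; exact htile κ
      _ = (L : ℝ) * ∑ κ : Fin d, ∑ x ∈ periodBox (d := d) (L * N'), ‖Y x κ‖ ^ 2 := by rw [Finset.mul_sum]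
      _ = (L : ℝ) * ∑ x ∈ periodBox (d := d) (L * N'), ∑ κ : Fin d, ‖Y x κ‖ ^ 2 := by rw [Finset.sum_comm]
  have step3 : c * (L * ∑ x ∈ periodBox (d := d) (L * N'), ∑ κ : Fin d, ‖Y x κ‖ ^ 2)
      = (L : ℝ) ^ 2 / (L : ℝ) ^ d * ∑ x ∈ periodBox (d := d) (L * N'), ∑ κ : Fin d, ‖Y x κ‖ ^ 2 := by
    rw [hc]; ring
  linarith [step1, step2, step3]

/-! ## §3 The one-level defect in ℓ²(torus) -/

/-- The explicit (crude, box-counting) ℓ² constant of the one-level defect: `C2sq d L = d²·Csup²·(2·nbRad+1)^{2d}`. [folklore] -/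
def C2sq (d L : ℕ) : ℝ := (d : ℝ) ^ 2 * Csup d L ^ 2 * ((2 * nbRad d L + 1 : ℕ) : ℝ) ^ (2 * d)

/-- The local ℓ¹ weight against the box sum: `locL1 L Y q κ ≤ Csup d L · dirL1 Y (box nbRad q)`. [folklore] -/
theorem locL1_le_Csup_mul_dirL1 (L : ℕ) (hL : 1 ≤ L) (Y : Site d → Fin d → Matrix n n ℂ) (q : Site d) (κ : Fin d) :
    locL1 L Y q κ ≤ Csup d L * dirL1 Y (box (nbRad d L) q) := by
  have hwt := BlockAveragePushDirSplit.sum_blockWeight_eq_one (d := d) L hL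
  have hD0 : 0 ≤ dirL1 Y (box (nbRad d L) q) := by
    unfold dirL1; exact Finset.sum_nonneg fun _ _ => Finset.sum_nonneg fun _ _ => norm_nonneg _
  have hseg0 : lnorm Y q (seg κ L) ≤ L * dirL1 Y (box (nbRad d L) q) := by
    have h := lnorm_le_region Y (z := q) (q := q) (R := nbRad d L) (seg κ (L : ℤ))
      (by rw [sub_self]; simp only [l1, Pi.zero_apply, Int.natAbs_zero, Finset.sum_const_zero, zero_add, length_seg,
            Int.natAbs_natCast, nbRad]; omega)
    rwa [length_seg, Int.natAbs_natCast] at h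
  have hloopL1 : loopL1 L Y q κ ≤ (nbRad d L : ℝ) * dirL1 Y (box (nbRad d L) q) := by
    unfold loopL1
    calc _ ≤ ∑ _r : Fin d → Fin L, ((L : ℝ) ^ d)⁻¹ * ((nbRad d L : ℝ) * dirL1 Y (box (nbRad d L) q)) := by
          refine Finset.sum_le_sum fun r _ => mul_le_mul_of_nonneg_left ?_ (by positivity)
          have h := lnorm_le_region Y (z := q) (q := q) (R := nbRad d L) (loopWord L κ (boxVec L r))
            (by rw [sub_self]; simp only [l1, Pi.zero_apply, Int.natAbs_zero, Finset.sum_const_zero, zero_add]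
                exact length_loopWord_le L κ r)
          exact h.trans (mul_le_mul_of_nonneg_right (by exact_mod_cast length_loopWord_le L κ r) hD0)
      _ = (nbRad d L : ℝ) * dirL1 Y (box (nbRad d L) q) := by rw [← Finset.sum_mul, hwt, one_mul]
  have htreeL1 : treeL1' L Y q κ ≤ (d * L : ℝ) * dirL1 Y (box (nbRad d L) q) := by
    unfold treeL1'
    calc _ ≤ ∑ _r : Fin d → Fin L, ((L : ℝ) ^ d)⁻¹ * ((d * L : ℝ) * dirL1 Y (box (nbRad d L) q)) := by
          refine Finset.sum_le_sum fun r _ => mul_le_mul_of_nonneg_left ?_ (by positivity)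
          have hlen : (treeWord (boxVec L r)).length ≤ d * L := by rw [length_treeWord]; exact l1_boxVec_le L r
          have hl := l1_natCast_smul_e (d := d) L κ
          have h := lnorm_le_region Y (z := q) (q := q + (L : ℤ) • e κ) (R := nbRad d L) (treeWord (boxVec L r))
            (by rw [add_sub_cancel_left, hl, length_treeWord, nbRad]; have := l1_boxVec_le L r; omega)
          exact h.trans (mul_le_mul_of_nonneg_right (by exact_mod_cast hlen) hD0)
      _ = (d * L : ℝ) * dirL1 Y (box (nbRad d L) q) := by rw [← Finset.sum_mul, hwt, one_mul]
  unfold locL1 Csup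
  nlinarith [hseg0, hloopL1, htreeL1, hD0]

/-- Cauchy–Schwarz on a box: `dirL1 Y (box R q)² ≤ d·(2R+1)^d · Σ_{x∈box R q} Σ_κ ‖Y x κ‖²`. [folklore] -/
theorem dirL1_box_sq_le (Y : Site d → Fin d → Matrix n n ℂ) (R : ℕ) (q : Site d) :
    dirL1 Y (box R q) ^ 2 ≤ (d : ℝ) * ((2 * R + 1 : ℕ) : ℝ) ^ d * ∑ x ∈ box R q, ∑ κ : Fin d, ‖Y x κ‖ ^ 2 := by
  rw [dirL1_eq_sum_prod]
  have h : (∑ b ∈ box R q ×ˢ (Finset.univ : Finset (Fin d)), ‖Y b.1 b.2‖) ^ 2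
      ≤ ((box R q ×ˢ (Finset.univ : Finset (Fin d))).card : ℝ) * ∑ b ∈ box R q ×ˢ (Finset.univ : Finset (Fin d)), ‖Y b.1 b.2‖ ^ 2 := by
    exact_mod_cast sq_sum_le_card_mul_sum_sq (s := box R q ×ˢ (Finset.univ : Finset (Fin d))) (f := fun b => ‖Y b.1 b.2‖)
  rw [Finset.card_product, card_box_eq, Finset.card_univ, Fintype.card_fin] at h
  refine h.trans (le_of_eq ?_)
  rw [Finset.sum_product]
  push_cast
  ring

/-- **THE ONE-LEVEL DEFECT IN ℓ²(TORUS)**: for unitary small-field `W` (`512(d+1)(d+4)L²a ≤ 1`, `SmallField W a`) and an `(L·N′)`-periodic `Y`,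
`l2sq (periodBox N′) (Dstr L W Y) ≤ (16(d+1)(d+4)L²a)²·C2sq d L·l2sq (periodBox (L·N′)) Y`. [folklore] -/
theorem l2sq_Dstr_le [Nonempty n] {L : ℕ} (hL : 1 ≤ L) {N' : ℕ} (hN' : 1 ≤ N') {W : Site d → Fin d → (Matrix n n ℂ)ˣ}
    (hWu : IsUnitaryCfg W) {a : ℝ} (ha : 0 ≤ a) (hsmall : 512 * (d + 1) * (d + 4) * (L : ℝ) ^ 2 * a ≤ 1) (hWa : SmallField W a)
    {Y : Site d → Fin d → Matrix n n ℂ} (hY : IsPeriodicDir Y ((L * N' : ℕ) : ℤ)) :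
    l2sq (periodBox (d := d) N') (Dstr L W Y)
      ≤ (16 * (d + 1) * (d + 4) * (L : ℝ) ^ 2 * a) ^ 2 * C2sq d L * l2sq (periodBox (d := d) (L * N')) Y := by
  set w : ℝ := 16 * (d + 1) * (d + 4) * (L : ℝ) ^ 2 * a with hw
  have hw0 : 0 ≤ w := by rw [hw]; positivity
  have hC := Csup_nonneg d L
  set R : ℕ := nbRad d L with hR
  set g : Site d → ℝ := fun x => ∑ κ : Fin d, ‖Y x κ‖ ^ 2 with hg
  -- pointwise
  have hpt : ∀ (y : Site d) (κ : Fin d), ‖Dstr L W Y y κ‖ ^ 2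
      ≤ w ^ 2 * Csup d L ^ 2 * ((d : ℝ) * ((2 * R + 1 : ℕ) : ℝ) ^ d * ∑ x ∈ box R ((L : ℤ) • y), g x) := by
    intro y κ
    have h1 : ‖Dstr L W Y y κ‖ ≤ w * locL1 L Y ((L : ℤ) • y) κ := by
      unfold Dstr; exact norm_Qbar_sub_Qstr_le hL hWu ha hsmall hWa Y y κ
    have h2 := locL1_le_Csup_mul_dirL1 (d := d) L hL Y ((L : ℤ) • y) κ
    have h3 := dirL1_box_sq_le (d := d) Y R ((L : ℤ) • y)
    have hD0 : 0 ≤ dirL1 Y (box R ((L : ℤ) • y)) := by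
      unfold dirL1; exact Finset.sum_nonneg fun _ _ => Finset.sum_nonneg fun _ _ => norm_nonneg _
    have h12 : ‖Dstr L W Y y κ‖ ≤ w * Csup d L * dirL1 Y (box R ((L : ℤ) • y)) := by
      rw [mul_assoc]; exact h1.trans (mul_le_mul_of_nonneg_left h2 hw0)
    have h0 : 0 ≤ ‖Dstr L W Y y κ‖ := norm_nonneg _
    calc ‖Dstr L W Y y κ‖ ^ 2 ≤ (w * Csup d L * dirL1 Y (box R ((L : ℤ) • y))) ^ 2 := pow_le_pow_left₀ h0 h12 2
      _ = w ^ 2 * Csup d L ^ 2 * dirL1 Y (box R ((L : ℤ) • y)) ^ 2 := by ring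
      _ ≤ w ^ 2 * Csup d L ^ 2 * ((d : ℝ) * ((2 * R + 1 : ℕ) : ℝ) ^ d * ∑ x ∈ box R ((L : ℤ) • y), g x) :=
          mul_le_mul_of_nonneg_left h3 (by positivity)
  -- the box multiplicity on the torus
  have hg0 : ∀ x, 0 ≤ g x := fun x => by rw [hg]; positivity
  have hgper : ∀ (x : Site d) (τ : Fin d), g (x + ((L * N' : ℕ) : ℤ) • e τ) = g x := by
    intro x τ; simp only [hg]; exact Finset.sum_congr rfl fun κ _ => by rw [hY x τ κ]
  have hbox := sum_periodBox_box_le L N' hL hN' R hg0 hgper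
  unfold l2sq
  calc ∑ y ∈ periodBox (d := d) N', ∑ κ : Fin d, ‖Dstr L W Y y κ‖ ^ 2
      ≤ ∑ y ∈ periodBox (d := d) N', ∑ _κ : Fin d,
          w ^ 2 * Csup d L ^ 2 * ((d : ℝ) * ((2 * R + 1 : ℕ) : ℝ) ^ d * ∑ x ∈ box R ((L : ℤ) • y), g x) :=
        Finset.sum_le_sum fun y _ => Finset.sum_le_sum fun κ _ => hpt y κ
    _ = w ^ 2 * Csup d L ^ 2 * ((d : ℝ) * ((2 * R + 1 : ℕ) : ℝ) ^ d) * (d : ℝ)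
          * ∑ y ∈ periodBox (d := d) N', ∑ x ∈ box R ((L : ℤ) • y), g x := by
        simp only [Finset.sum_const, Finset.card_univ, Fintype.card_fin, nsmul_eq_mul, ← Finset.mul_sum]
        ring
    _ ≤ w ^ 2 * Csup d L ^ 2 * ((d : ℝ) * ((2 * R + 1 : ℕ) : ℝ) ^ d) * (d : ℝ)
          * (((2 * R + 1 : ℕ) : ℝ) ^ d * ∑ x ∈ periodBox (d := d) (L * N'), g x) := by
        refine mul_le_mul_of_nonneg_left ?_ (by positivity)
        exact_mod_cast hbox
    _ = w ^ 2 * C2sq d L * ∑ x ∈ periodBox (d := d) (L * N'), ∑ κ : Fin d, ‖Y x κ‖ ^ 2 := by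
        simp only [hg, C2sq, hR]
        ring

end

end Summit.QuantumFields.BalabanUV.T4Continuum.NE3CovariantLineSumsL2
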